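import Literature.NumberTheory.GaloisRepresentations.SUnitsRestrictedCohomologyDegreeTwoTorsionFinite
import Literature.NumberTheory.GaloisRepresentations.SUnitsLayerInvariantsRealisation
import Mathlib.GroupTheory.SpecificGroups.Cyclic
import HarnessLib

/-!
# The `p`-torsion of `H²(U, E_S)` has AT MOST `p^{#S₀ − 1}` elements: the invariants at `S₀ ∖ {v₀}` already separate
# (`K` totally complex, `U = H/N_S ≤ G_{K,S}` open, `S₀` = the places of `F₀ = K̄^H` above `S`, `v₀ ∈ S₀`)
# (Neukirch–Schmidt–Wingberg (8.3.11) (ii)/(iii): `H²(G_S(F₀), E_S)(p) ↪ ker(⊕_{v ∈ S(F₀)} ℚ_p/ℤ_p →Σ ℚ_p/ℤ_p)`, as a COUNT)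

Topic `NumberTheory/GaloisRepresentations`; namespace `Literature.NumberTheory.GaloisRepresentations.SUnits.Layers`.
THEOREMS ONLY (no definition, no named fact, no `sorry`, no instance; D-0026).  Lane «TATE-EPC-TC» of cell `bsd-eis`
(crux `GoodLatticeBDPValue`, stmt-BirchSwinnertonDyer-19032; brick (F2-exact), colimit half, part 1 of 2).  Sequel of
`SUnitsRestrictedCohomologyDegreeTwoTorsionFinite` (F2b: the count `≤ p^{#S₀}` through the layer invariant
`(inv_v)_{v ∈ S₀}`) and `SUnitsLayerInvariantsRealisation` (the invariants are SUM-ZERO).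

* §0 `natCard_addCircle_torsion_eq` — `#{a ∈ ℚ/ℤ | p • a = 0} = p` (`p` prime); `natCard_pi_addCircle_torsion_eq`.
* §1 `exists_layer_torsion_invariant_erase`, **`finsetCard_torsion_le_card_pi_erase`**: every finite set of `p`-torsion
  classes of `H²(U, E_S)` has at most `#(S₀ ∖ {v₀} → (ℚ/ℤ)[p])` elements (`v₀ ∈ S₀`): the invariants at `S₀` of a
  layer class sum to zero (`sum_localInv_layerCohomologyIso_eq_zero`), so those at `S₀ ∖ {v₀}` already separate
  (F2b `inflG_eq_of_localInv_eq`); count by `DiscreteRepLayerColimitTorsionBounded`.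

The reverse inequality (realisation of every family) and the equality `#H²(U, E_S)[p] = p^{#S₀ − 1}` are the sequel
`SUnitsRestrictedCohomologyDegreeTwoTorsionCount`.  HONEST FRAMING: a count; totally complex base only; no statement of
a Summit, not Tate's formula, not the crux is proved here; 0 cells / labels / tiers move.

## References
* J. Neukirch, A. Schmidt, K. Wingberg, *Cohomology of Number Fields*, 2nd ed. (2008), VIII §3 (8.3.10)–(8.3.11), (1.5.1).
  [NeukirchSchmidtWingberg2008]
* J.-P. Serre, *Cohomologie galoisienne* (1994), I §2.2 Prop. 8. [SerreGaloisCohomology1997]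
* J. W. S. Cassels, A. Fröhlich (eds.), *Algebraic Number Theory* (1967), Ch. VII (J. Tate) §7.3 Cor. 7.4, §11.2.
  [CasselsFrohlichANT1967]
-/

noncomputable section

open NumberField IsDedekindDomain Field Topology CategoryTheory
open Literature.NumberTheory.GaloisRepresentations.IdeleClassBar (GalLayer)
open Literature.NumberTheory.GaloisRepresentations.LocalWeilDatum (galFixing galFixing_sup)
open Literature.NumberTheory.IwasawaTheory.Greenberg2006 (galoisGroupAbove)
open Literature.NumberTheory.GaloisRepresentations.OpenSubgroupLayer (algOfLE isScalarTower_algOfLE baseField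
  exists_layerSubgroup_le layerSubgroup_anti)
open Literature.Algebra.Homology Literature.Algebra.Homology.DiscreteRep
open Literature.Algebra.Homology.DiscreteRep.LayerColimit (stepG inflG inflG_stepG stepG_stepG exists_stepG_eq_stepG)

namespace Literature.NumberTheory.GaloisRepresentations

namespace SUnits

namespace Layers

variable {K : Type} [Field K] [NumberField K] {S : Set (HeightOneSpectrum (𝓞 K))}
  {H : Subgroup (absoluteGaloisGroup K)}

/-! ### §0. `#(ℚ/ℤ)[p] = p` -/

/-- **`#{a ∈ ℚ/ℤ | p • a = 0} = p`** for a prime `p` (the `p − 1` elements of order `p` and `0`).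
[cite: CasselsFrohlichANT1967, Ch. VII §7.3 Cor. 7.4] -/
theorem natCard_addCircle_torsion_eq {p : ℕ} (hp : p.Prime) : Nat.card {a : AddCircle (1 : ℚ) // p • a = 0} = p := by
  classical
  haveI : Fact ((0 : ℚ) < 1) := ⟨one_pos⟩
  haveI := finite_addCircle_torsion hp.pos
  refine le_antisymm (natCard_addCircle_torsion_le hp.pos) ?_
  -- the elements of order `p`, and `0`
  have hcard : Nat.card {u : AddCircle (1 : ℚ) // addOrderOf u = p} = p - 1 := by
    rw [AddCircle.card_addOrderOf_eq_totient, Nat.totient_prime hp]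
  haveI : Finite {u : AddCircle (1 : ℚ) // addOrderOf u = p} :=
    Nat.finite_of_card_ne_zero (by rw [hcard]; have := hp.two_le; omega)
  let f : Option {u : AddCircle (1 : ℚ) // addOrderOf u = p} → {a : AddCircle (1 : ℚ) // p • a = 0} := fun o =>
    match o with
    | none => ⟨0, smul_zero _⟩
    | some u => ⟨u.1, by have h := addOrderOf_nsmul_eq_zero u.1; rwa [u.2] at h⟩
  have hf : Function.Injective f := by
    rintro (_ | u) (_ | u') h
    · rfl
    · have h0 := congrArg Subtype.val h
      change (0 : AddCircle (1 : ℚ)) = u'.1 at h0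
      have h1 : addOrderOf (u'.1 : AddCircle (1 : ℚ)) = p := u'.2
      rw [← h0, addOrderOf_zero] at h1
      exact absurd h1 hp.one_lt.ne
    · have h0 := congrArg Subtype.val h
      change (u.1 : AddCircle (1 : ℚ)) = 0 at h0
      have h1 : addOrderOf (u.1 : AddCircle (1 : ℚ)) = p := u.2
      rw [h0, addOrderOf_zero] at h1
      exact absurd h1 hp.one_lt.ne
    · have h' := congrArg Subtype.val h
      change (u.1 : AddCircle (1 : ℚ)) = u'.1 at h'
      exact congrArg some (Subtype.ext h')
  haveI := Fintype.ofFinite {u : AddCircle (1 : ℚ) // addOrderOf u = p}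
  calc p = p - 1 + 1 := (Nat.sub_add_cancel hp.one_lt.le).symm
    _ = Nat.card (Option {u : AddCircle (1 : ℚ) // addOrderOf u = p}) := by
          rw [Nat.card_eq_fintype_card (α := Option _), Fintype.card_option, ← Nat.card_eq_fintype_card, hcard]
    _ ≤ Nat.card {a : AddCircle (1 : ℚ) // p • a = 0} := Nat.card_le_card_of_injective f hf

/-- `#(T → (ℚ/ℤ)[p]) = p ^ #T` for a finset-indexed `T`. [cite: CasselsFrohlichANT1967, Ch. VII §7.3 Cor. 7.4] -/
theorem natCard_pi_addCircle_torsion_eq {ι : Type} (T : Finset ι) {p : ℕ} (hp : p.Prime) :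
    Nat.card (↥T → {a : AddCircle (1 : ℚ) // p • a = 0}) = p ^ T.card := by
  classical
  haveI := finite_addCircle_torsion hp.pos
  haveI := Fintype.ofFinite {a : AddCircle (1 : ℚ) // p • a = 0}
  rw [Nat.card_eq_fintype_card, Fintype.card_pi, Finset.prod_const, Finset.card_univ, Fintype.card_coe,
    ← Nat.card_eq_fintype_card, natCard_addCircle_torsion_eq hp]

/-! ### §1. Upper bound: the invariants at `S₀ ∖ {v₀}` separate -/

/-- The invariants of a layer class (read through `layerCohomologyIso`) sum to zero over `S₀`
(`sum_localInv_eq_zero` of `SUnitsLayerInvariantsRealisation`, at `F₀ = K̄^H`).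
[cite: NeukirchSchmidtWingberg2008, VIII §3 (8.3.10)–(8.3.11)] -/
theorem sum_localInv_layerCohomologyIso_eq_zero [IsTotallyComplex K] (hHo : IsOpen (H : Set (absoluteGaloisGroup K)))
    [NumberField ↥(baseField H)] (S₀ : Finset (HeightOneSpectrum (𝓞 ↥(baseField H))))
    (hSF : ∀ u : HeightOneSpectrum (𝓞 ↥(baseField H)), u ∈ S₀ ↔ u.under (𝓞 K) ∈ S)
    (E : GalLayer K) (hF : baseField H ≤ E.1) (hS : ramificationSubgroup K S ≤ galFixing K E.1)
    (c : groupCohomology (layerRep hHo E hF hS) 2) :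
    letI := algOfLE hF
    haveI := isScalarTower_algOfLE (K := K) hF
    haveI := E.isGalois
    haveI : NumberField ↥E.1 := E.numberField
    haveI : IsGalois ↥(baseField H) ↥E.1 := IsGalois.tower_top_of_isGalois K ↥(baseField H) ↥E.1
    ∑ v ∈ S₀, IdeleCohomology.localInv ↥E.1 v
      (groupCohomology.map (MonoidHom.id _) (IdeleCohomology.ideleSRepHom S₀) 2
        (groupCohomology.map (MonoidHom.id _) (IdeleCohomology.sUnitsToIdeleS (K := K) (E := ↥E.1) S S₀ hSF) 2
          ((layerCohomologyIso hHo E hF hS 2).hom c))) = 0 :=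
  haveI := E.finiteDimensional
  haveI := E.isGalois
  sum_localInv_eq_zero S hF hS S₀ hSF ((layerCohomologyIso hHo E hF hS 2).hom c)

open scoped Classical in
/-- **The layer invariant at `S₀ ∖ {v₀}` separates the `p`-torsion classes** (`K` totally complex, `v₀ ∈ S₀`): there is
a function `θ` from the `p`-torsion classes of the layer to `S₀ ∖ {v₀} → (ℚ/ℤ)[p]` with `θ c = θ c' → inflG c = inflG c'`
(the invariants at `S₀` sum to zero, so those at `S₀ ∖ {v₀}` determine the one at `v₀`; then F2b's
`inflG_eq_of_localInv_eq`). [cite: NeukirchSchmidtWingberg2008, VIII §3 (8.3.11) (ii)/(iii)]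
[cite: SerreGaloisCohomology1997, I §2.2 Prop. 8] -/
theorem exists_layer_torsion_invariant_erase [IsTotallyComplex K] (hHo : IsOpen (H : Set (absoluteGaloisGroup K)))
    [NumberField ↥(baseField H)] (S₀ : Finset (HeightOneSpectrum (𝓞 ↥(baseField H))))
    (hSF : ∀ u : HeightOneSpectrum (𝓞 ↥(baseField H)), u ∈ S₀ ↔ u.under (𝓞 K) ∈ S)
    (E : GalLayer K) (hF : baseField H ≤ E.1) (hS : ramificationSubgroup K S ≤ galFixing K E.1)
    {v₀ : HeightOneSpectrum (𝓞 ↥(baseField H))} (hv₀ : v₀ ∈ S₀) (p : ℕ) :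
    haveI := compactSpace_above K S H hHo
    ∃ θ : {c : groupCohomology (layerRep hHo E hF hS) 2 // p • c = 0} →
        (↥(S₀.erase v₀) → {a : AddCircle (1 : ℚ) // p • a = 0}),
      ∀ c c', θ c = θ c' →
        inflG (OpenSubgroupLayer.layerSubgroup S hHo E hF hS) (resD K S H hHo) 2 c.1 =
          inflG (OpenSubgroupLayer.layerSubgroup S hHo E hF hS) (resD K S H hHo) 2 c'.1 := by
  haveI := compactSpace_above K S H hHo
  letI := algOfLE hF
  haveI := isScalarTower_algOfLE (K := K) hF
  haveI := E.isGalois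
  haveI : NumberField ↥E.1 := E.numberField
  haveI : IsGalois ↥(baseField H) ↥E.1 := IsGalois.tower_top_of_isGalois K ↥(baseField H) ↥E.1
  -- the readout `r c v = inv_v (ι c)` (ONE elaboration of the composite)
  obtain ⟨r, hr⟩ : ∃ r : groupCohomology (layerRep hHo E hF hS) 2 → HeightOneSpectrum (𝓞 ↥(baseField H)) →
      AddCircle (1 : ℚ), ∀ c v, r c v = IdeleCohomology.localInv ↥E.1 v
        (groupCohomology.map (MonoidHom.id _) (IdeleCohomology.ideleSRepHom S₀) 2
          (groupCohomology.map (MonoidHom.id _) (IdeleCohomology.sUnitsToIdeleS (K := K) (E := ↥E.1) S S₀ hSF) 2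
            ((layerCohomologyIso hHo E hF hS 2).hom c))) := ⟨_, fun _ _ => rfl⟩
  -- `p • c = 0 ⟹ p • r c v = 0` (all maps additive)
  have htors : ∀ c : groupCohomology (layerRep hHo E hF hS) 2, p • c = 0 →
      ∀ v : HeightOneSpectrum (𝓞 ↥(baseField H)), p • r c v = 0 := fun c hc v => by
    rw [hr, ← map_nsmul, ← map_nsmul, ← map_nsmul, ← map_nsmul, hc, map_zero, map_zero, map_zero, map_zero]
  -- the readouts sum to zero over `S₀`
  have hsum0 : ∀ c : groupCohomology (layerRep hHo E hF hS) 2, ∑ v ∈ S₀, r c v = 0 := fun c => by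
    rw [Finset.sum_congr rfl fun v _ => hr c v]
    exact sum_localInv_layerCohomologyIso_eq_zero hHo S₀ hSF E hF hS c
  -- equal readouts at `S₀` ⟹ equal images in the colimit (F2b)
  have hsep : ∀ c c' : groupCohomology (layerRep hHo E hF hS) 2, (∀ v ∈ S₀, r c v = r c' v) →
      inflG (OpenSubgroupLayer.layerSubgroup S hHo E hF hS) (resD K S H hHo) 2 c =
        inflG (OpenSubgroupLayer.layerSubgroup S hHo E hF hS) (resD K S H hHo) 2 c' := fun c c' h => by
    refine inflG_eq_of_localInv_eq hHo S₀ hSF E hF hS c c' fun v hv => ?_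
    have h1 := h v hv
    rw [hr, hr] at h1
    exact h1
  -- equal readouts at `S₀ ∖ {v₀}` ⟹ equal readouts at `S₀` (sum zero)
  have hext : ∀ c c' : groupCohomology (layerRep hHo E hF hS) 2,
      (∀ w : ↥(S₀.erase v₀), r c w.1 = r c' w.1) → ∀ v ∈ S₀, r c v = r c' v := fun c c' h v hv => by
    by_cases hvv : v = v₀
    · have e : ∀ d : groupCohomology (layerRep hHo E hF hS) 2, r d v₀ = -∑ x ∈ S₀.erase v₀, r d x := fun d =>
        eq_neg_of_add_eq_zero_left ((Finset.add_sum_erase S₀ (r d) hv₀).trans (hsum0 d))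
      rw [hvv, e, e, Finset.sum_congr rfl fun x hx => (h ⟨x, hx⟩ : r c x = r c' x)]
    · exact h ⟨v, Finset.mem_erase.2 ⟨hvv, hv⟩⟩
  refine ⟨fun c w => ⟨r c.1 w.1, htors c.1 c.2 w.1⟩, fun c c' hcc' => hsep c.1 c'.1 (hext c.1 c'.1 fun w => ?_)⟩
  exact congrArg Subtype.val (congrFun hcc' w)

open scoped Classical in
/-- **UPPER BOUND.**  Every finite set of `p`-torsion classes of `H²(U, E_S)` has at most `#(S₀ ∖ {v₀} → (ℚ/ℤ)[p])`
elements (`K` totally complex, `S` finite, `v₀ ∈ S₀`). [cite: NeukirchSchmidtWingberg2008, VIII §3 (8.3.11) (ii)/(iii)]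
[cite: SerreGaloisCohomology1997, I §2.2 Prop. 8] -/
theorem finsetCard_torsion_le_card_pi_erase [IsTotallyComplex K] (hHo : IsOpen (H : Set (absoluteGaloisGroup K)))
    (hNH : ramificationSubgroup K S ≤ H) [NumberField ↥(baseField H)]
    (S₀ : Finset (HeightOneSpectrum (𝓞 ↥(baseField H))))
    (hSF : ∀ u : HeightOneSpectrum (𝓞 ↥(baseField H)), u ∈ S₀ ↔ u.under (𝓞 K) ∈ S)
    {v₀ : HeightOneSpectrum (𝓞 ↥(baseField H))} (hv₀ : v₀ ∈ S₀) {p : ℕ} (hp : 0 < p)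
    (s : Finset (continuousCohomology 2 (resRep K S H).toTopRep)) (hs : ∀ y ∈ s, p • y = 0) :
    s.card ≤ Nat.card (↥(S₀.erase v₀) → {a : AddCircle (1 : ℚ) // p • a = 0}) := by
  haveI := compactSpace_above K S H hHo
  haveI := totallyDisconnectedSpace_above (S := S) (H := H)
  haveI := finite_addCircle_torsion hp
  have hlay : ∀ W : OpenNormalSubgroup ↥(galoisGroupAbove S H),
      ∃ (V : OpenNormalSubgroup ↥(galoisGroupAbove S H)) (_ : (V : Subgroup ↥(galoisGroupAbove S H)) ≤ W)
        (θ : {c : groupCohomology ((invariantsQuotFunctor ℤ (V : Subgroup ↥(galoisGroupAbove S H))).obj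
          (resD K S H hHo)) 2 // p • c = 0} → (↥(S₀.erase v₀) → {a : AddCircle (1 : ℚ) // p • a = 0})),
        ∀ c c', θ c = θ c' → inflG V (resD K S H hHo) 2 c.1 = inflG V (resD K S H hHo) 2 c'.1 := by
    intro W
    obtain ⟨E, hF, hS, hle⟩ := exists_layerSubgroup_le S hHo hNH W
    obtain ⟨θ, hθ⟩ := exists_layer_torsion_invariant_erase hHo S₀ hSF E hF hS hv₀ p
    exact ⟨OpenSubgroupLayer.layerSubgroup S hHo E hF hS, hle, θ, hθ⟩
  exact LayerColimit.finsetCard_continuousCohomology_le_of_cofinal_torsion_invariant (resRep K S H).toTopRep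
    (isDiscrete_resRep K S H) 2 p hlay s hs

end Layers

end SUnits

end Literature.NumberTheory.GaloisRepresentations

end
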